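import Summits.QuantumFields.BalabanUV.Beta.FP.TowerQN2RowFamily
import Summits.QuantumFields.BalabanUV.Beta.NVertexGradedRecordLetters

/-!
# `BalabanUV.Beta.FP.WoundEvenCovariantFamily` — road «FP», binder row D1, ROUTE T, (T1) ∕ v10G ∕ v11-R (B5 of XREAD-1; an2 W-2 (A)(2), PART 93∕94):
# **`TowerQN2RowFamily` §1–§2 FOR ANY JOINTLY BLOCK-COVARIANT SECOND-ORDER FAMILY, AND THE GRADED N-RECORD INSTANCE** — the wound even family
# `x w ↦ Σ'_e W♮ μ y ν (y′ + M∘e) x w` of ANY `W : Fin 4 → ℤ⁴ → Fin 4 → ℤ⁴ → MKer 4 (Fib 3)` with `W μ (y+t) ν (y′+t) = shiftK (−Lc^(n+2)•t) (W μ y ν y′)` has a torus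
# matrix `perF T (dper T ·)` (`T = towerTorus Lc (fine Lc M) (n+1)`) separately `M`-periodic in both labels, so both labels may be read at `wrap M`; the record's `WN` (PART 8
# = `TowerQN2RowFamily`, road g44) and the GRADED composite family of (T1) (an2 PART 93 `NVertexGradedRecordLetters`: `WchartOf (fun _ => compChart …) (tabsCompG …) … 0`)
# are the two instances

WHY.  v10's door chain (`TowerHN2RowDoor.hHN2_family_of_locks_of_junctions_door`, the ONE file's `hHN₂`) reads the family form through PART 8's `perF_dper_woundEven_wrap`,
whose statement names `WN (Roots.ctr Lc) Pn (n+1)`; under (T1) (`hM₂′`, `compMixG`) the second-order chain ends in the GRADED family (an2 FINDING AN2-84-1, PART 94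
`perF_dper_wound_WNG_evenHalf_inl_inl_eq_sum`), so the road's graded door twins need the same letter for that family.  PART 8's proofs use `WN` only through its JOINT
block covariance (`WN_translate_eq_shiftK`); THIS FILE states §1–§2 once for a generic `W` with that covariance DISPLAYED (`hWt`), and §3 inhabits `hWt` for the graded family
(lit `W2SymOfK_translate` fed an2's PART 93 letters `SNG_translate ∕ T2NG_translate`, PART 16 `shiftK_AN`, the graded record's `hMt ∕ hmixt`, through PART 93 `WNG_eq_W2SymOfK` —
PART 8's four-line proof with the graded names).

WHAT ([folklore] `tsum`∕`shiftK` bookkeeping BY NAME; no `def`, no `def … : Prop`, nothing cited, 0 sorry):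
§1 generic `W`: **`woundEven_translate_snd_of`** (no covariance needed), **`woundEven_translate_fst_of`**, **`perF_dper_woundEven_translate_fst_of ∕ _snd_of`**,
**`perF_dper_woundEven_wrap_of`** (both labels at `wrap M`) — PART 8 §2 VERBATIM with `WN R P (n+1) ↦ W` and `WN_translate_eq_shiftK ↦ hWt`;
§2 the graded instance: **`WNG_translate_eq_shiftK`**, **`perF_dper_woundEvenG_wrap`**.
WHAT THIS IS NOT: nothing on the door `𝒲Δ′ ∕ hX′` (AN2-84-1, by value first); nothing of Bałaban's asserted, valued or discharged; 0 estimates; 0∕4 row-D1 binders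
(hW, hR, D1Tel, D1Rep); ROOT M‴ p325680 ∕ P5c ∕ D6 untouched; NOT (C1), NOT (T-ID), NOT D1, NEVER «G-an2-4 closed», NOT BetaPertH, NOT continuum, NOT Clay.

HONEST DEPENDENCY (page 1, mandatory): continuum YM on T⁴ ⇐ BetaPertH ∧ nine spine estimates (0/9 proved); BetaPertH ⇐ (D1) ∧ (D4) ∧ CAP+tail;
G-an2-4 gates asym, D1 and NE2/3/4.  HONEST FRAMING (cell contract, verbatim): «discharging `BetaPertH` makes Bałaban's UV stability UNCONDITIONAL —
a real constructive-QFT result; it is NOT the continuum limit and NOT the Clay problem.»  ABSOLUTE RULE (cell charter, verbatim): «No internally-minted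
statement may enter as a cited fact. Every hypothesis is either kernel-proved in this package or a verbatim quotation of a PUBLISHED theorem with page
reference. The manuscript(s) under audit are NOT citable for their own disputed steps — they are the thing under adjudication; programme-internal
(2001/route/tribunal) claims are never citable.»  Road «FP» OWNER, b2b-balaban-beta-d1-p3 gen 61, 2026-08-30.  No existing file touched.
-/

noncomputable section

open scoped BigOperators

namespace Summit.QuantumFields.BalabanUV.Beta.FP.WoundEvenCovariantFamily

open Literature.MathematicalPhysics.QuantumFieldTheory
open Literature.MathematicalPhysics.QuantumFieldTheory.Balaban1983to89
open Literature.MathematicalPhysics.QuantumFieldTheory.Balaban1983to89.Beta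
open B4TorusKernel.MultiPeriod (translate translate_apply)
open B4Reflection242 (translate_translate)
open B5Prop11Plancherel (fine)
open B6Lemma24Torus (pbox wrap)
open AffineAveraging (Site)
open ExpKernelCalculus (MKer shiftK)
open OneStepResolventKernel (Fib)
open BalabanStepW2 (M2Of_translate)
open SecondOrderResponse (W2SymOfK_translate)
open Summit.QuantumFields.BalabanUV.Beta.TameKernelCalculus (trK)
open Summit.QuantumFields.BalabanUV.Beta.BorderedHessian (sgnK)
open Summit.QuantumFields.BalabanUV.Beta.AxialDressingRooted (one_le_of_neZero)
open Summit.QuantumFields.BalabanUV.Beta.ChartStepJets (WchartOf)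
open Summit.QuantumFields.BalabanUV.Beta.CompositeOneShotJetsGraded (tabsCompG)
open Summit.QuantumFields.BalabanUV.Beta.CompositeOneShotJetData (Roots Pins)
open Summit.QuantumFields.BalabanUV.Beta.CompositeCorrectorDress (compChart)
open Summit.QuantumFields.BalabanUV.Beta.GAN24.KernelPeriodisation (quo translate_wrap_quo)
open Summit.QuantumFields.BalabanUV.Beta.FP.KernelPeriodisationFib (perF)
open Summit.QuantumFields.BalabanUV.Beta.FP.KernelPeriodisationFibLoc (dper)
open Summit.QuantumFields.BalabanUV.Beta.FP.TorusCompositeObjects (towerTorus towerTorus_apply)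
open Summit.QuantumFields.BalabanUV.Beta.FP.TowerN1RowsFamily (dper_shiftK_period)
open Summit.QuantumFields.BalabanUV.Beta.FP.TowerQN2RowFamily (evenHalf_shiftK)
open Summit.QuantumFields.BalabanUV.Beta.NVertexWoundPeriodised (shiftK_AN)
open Summit.QuantumFields.BalabanUV.Beta.NVertexGradedRecord (WNG_eq_W2SymOfK SNG_translate T2NG_translate)

/-! ## §1 The wound even family of ANY jointly block-covariant `W` is separately `M`-periodic in both labels -/

section Generic

variable {Lc : ℕ} (n : ℕ) (M : Fin (3 + 1) → ℕ) (W : Fin (3 + 1) → Site (3 + 1) → Fin (3 + 1) → Site (3 + 1) → MKer (3 + 1) (Fib 3))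

/-- [folklore] **`woundEven_translate_snd_of` — the SECOND label** (no covariance needed): winding `y′ + M∘m` is winding `y′` re-indexed (`translate_translate`, `Equiv.addLeft`). -/
theorem woundEven_translate_snd_of (μ : Fin (3 + 1)) (y : Site (3 + 1)) (ν : Fin (3 + 1)) (y' m : Site (3 + 1)) :
    (fun x w a b => ∑' e : Site (3 + 1), ((1 / 2 : ℝ) • (W μ y ν (translate M (translate M y' m) e)
        + sgnK (trK (W μ y ν (translate M (translate M y' m) e))))) x w a b)
      = fun x w a b => ∑' e : Site (3 + 1), ((1 / 2 : ℝ) • (W μ y ν (translate M y' e)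
        + sgnK (trK (W μ y ν (translate M y' e))))) x w a b := by
  funext x w a b
  simp only [translate_translate]
  exact (Equiv.addLeft m).tsum_eq (fun e => ((1 / 2 : ℝ) • (W μ y ν (translate M y' e)
    + sgnK (trK (W μ y ν (translate M y' e))))) x w a b)

/-- [folklore] **`woundEven_translate_fst_of` — the FIRST label**, for a jointly block-covariant `W` (`hWt`): shifting `y ↦ y + M∘m` is a joint shift of the pair `(y, y′ + M∘e)`
by `M∘m` after re-indexing `e ↦ e − m`, hence a simultaneous shift of both lattice arguments by the torus period `T∘m`, `T = towerTorus Lc (fine Lc M) (n+1)`. -/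
theorem woundEven_translate_fst_of
    (hWt : ∀ (μ : Fin (3 + 1)) (y : Site (3 + 1)) (ν : Fin (3 + 1)) (y' t : Site (3 + 1)),
      W μ (y + t) ν (y' + t) = shiftK (-(((Lc ^ (n + 1 + 1) : ℕ) : ℤ) • t)) (W μ y ν y'))
    (μ : Fin (3 + 1)) (y : Site (3 + 1)) (ν : Fin (3 + 1)) (y' m : Site (3 + 1)) :
    (fun x w a b => ∑' e : Site (3 + 1), ((1 / 2 : ℝ) • (W μ (translate M y m) ν (translate M y' e)
        + sgnK (trK (W μ (translate M y m) ν (translate M y' e))))) x w a b)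
      = shiftK (fun i => (towerTorus Lc (fine Lc M) (n + 1) i : ℤ) * (-m) i)
          (fun x w a b => ∑' e : Site (3 + 1), ((1 / 2 : ℝ) • (W μ y ν (translate M y' e)
            + sgnK (trK (W μ y ν (translate M y' e))))) x w a b) := by
  -- the joint shift vector
  have hvec : -(((Lc ^ (n + 1 + 1) : ℕ) : ℤ) • (fun i => (M i : ℤ) * m i)) = fun i => (towerTorus Lc (fine Lc M) (n + 1) i : ℤ) * (-m) i := by
    funext i
    simp only [Pi.neg_apply, Pi.smul_apply, smul_eq_mul, towerTorus_apply]
    push_cast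
    ring
  have hy : translate M y m = y + (fun i => (M i : ℤ) * m i) := by
    funext i; simp only [translate_apply, Pi.add_apply]
  have hy' : ∀ e : Site (3 + 1), translate M y' e = translate M y' (e - m) + (fun i => (M i : ℤ) * m i) := fun e => by
    funext i; simp only [translate_apply, Pi.add_apply, Pi.sub_apply]; ring
  funext x w a b
  -- termwise: joint covariance, then the even half through the shift
  have hterm : ∀ e : Site (3 + 1), ((1 / 2 : ℝ) • (W μ (translate M y m) ν (translate M y' e)
        + sgnK (trK (W μ (translate M y m) ν (translate M y' e))))) x w a b
      = shiftK (fun i => (towerTorus Lc (fine Lc M) (n + 1) i : ℤ) * (-m) i)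
          ((1 / 2 : ℝ) • (W μ y ν (translate M y' (e - m)) + sgnK (trK (W μ y ν (translate M y' (e - m)))))) x w a b := by
    intro e
    rw [hy, hy' e, hWt μ y ν (translate M y' (e - m)), hvec, evenHalf_shiftK]
  simp_rw [hterm]
  exact (Equiv.subRight m).tsum_eq (fun e => shiftK (fun i => (towerTorus Lc (fine Lc M) (n + 1) i : ℤ) * (-m) i)
    ((1 / 2 : ℝ) • (W μ y ν (translate M y' e) + sgnK (trK (W μ y ν (translate M y' e))))) x w a b)

/-- [folklore] **`perF_dper_woundEven_translate_fst_of`** — the torus matrix of the wound even family is `M`-periodic in the FIRST label (`woundEven_translate_fst_of` +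
#5 `dper_shiftK_period`). -/
theorem perF_dper_woundEven_translate_fst_of
    (hWt : ∀ (μ : Fin (3 + 1)) (y : Site (3 + 1)) (ν : Fin (3 + 1)) (y' t : Site (3 + 1)),
      W μ (y + t) ν (y' + t) = shiftK (-(((Lc ^ (n + 1 + 1) : ℕ) : ℤ) • t)) (W μ y ν y'))
    (μ : Fin (3 + 1)) (y : Site (3 + 1)) (ν : Fin (3 + 1)) (y' m : Site (3 + 1)) :
    perF (towerTorus Lc (fine Lc M) (n + 1)) (dper (towerTorus Lc (fine Lc M) (n + 1))
        (fun x w a b => ∑' e : Site (3 + 1), ((1 / 2 : ℝ) • (W μ (translate M y m) ν (translate M y' e)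
          + sgnK (trK (W μ (translate M y m) ν (translate M y' e))))) x w a b))
      = perF (towerTorus Lc (fine Lc M) (n + 1)) (dper (towerTorus Lc (fine Lc M) (n + 1))
        (fun x w a b => ∑' e : Site (3 + 1), ((1 / 2 : ℝ) • (W μ y ν (translate M y' e)
          + sgnK (trK (W μ y ν (translate M y' e))))) x w a b)) := by
  rw [woundEven_translate_fst_of n M W hWt μ y ν y' m, dper_shiftK_period]

/-- [folklore] **`perF_dper_woundEven_translate_snd_of`** — and in the SECOND label (`woundEven_translate_snd_of`). -/
theorem perF_dper_woundEven_translate_snd_of (μ : Fin (3 + 1)) (y : Site (3 + 1)) (ν : Fin (3 + 1)) (y' m : Site (3 + 1)) :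
    perF (towerTorus Lc (fine Lc M) (n + 1)) (dper (towerTorus Lc (fine Lc M) (n + 1))
        (fun x w a b => ∑' e : Site (3 + 1), ((1 / 2 : ℝ) • (W μ y ν (translate M (translate M y' m) e)
          + sgnK (trK (W μ y ν (translate M (translate M y' m) e))))) x w a b))
      = perF (towerTorus Lc (fine Lc M) (n + 1)) (dper (towerTorus Lc (fine Lc M) (n + 1))
        (fun x w a b => ∑' e : Site (3 + 1), ((1 / 2 : ℝ) • (W μ y ν (translate M y' e)
          + sgnK (trK (W μ y ν (translate M y' e))))) x w a b)) := by
  rw [woundEven_translate_snd_of M W μ y ν y' m]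

/-- [folklore] **`perF_dper_woundEven_wrap_of` — BOTH LABELS MAY BE READ AT THEIR BOX REPRESENTATIVES**, for a jointly block-covariant `W`:
`… (wound even at (μ, wrap M y; ν, wrap M y′)) = … (wound even at (μ, y; ν, y′))` (`translate_wrap_quo` twice). -/
theorem perF_dper_woundEven_wrap_of [∀ μ, NeZero (M μ)]
    (hWt : ∀ (μ : Fin (3 + 1)) (y : Site (3 + 1)) (ν : Fin (3 + 1)) (y' t : Site (3 + 1)),
      W μ (y + t) ν (y' + t) = shiftK (-(((Lc ^ (n + 1 + 1) : ℕ) : ℤ) • t)) (W μ y ν y'))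
    (μ : Fin (3 + 1)) (y : Site (3 + 1)) (ν : Fin (3 + 1)) (y' : Site (3 + 1)) :
    perF (towerTorus Lc (fine Lc M) (n + 1)) (dper (towerTorus Lc (fine Lc M) (n + 1))
        (fun x w a b => ∑' e : Site (3 + 1), ((1 / 2 : ℝ) • (W μ (wrap M y : Site (3 + 1)) ν (translate M (wrap M y' : Site (3 + 1)) e)
          + sgnK (trK (W μ (wrap M y : Site (3 + 1)) ν (translate M (wrap M y' : Site (3 + 1)) e))))) x w a b))
      = perF (towerTorus Lc (fine Lc M) (n + 1)) (dper (towerTorus Lc (fine Lc M) (n + 1))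
        (fun x w a b => ∑' e : Site (3 + 1), ((1 / 2 : ℝ) • (W μ y ν (translate M y' e)
          + sgnK (trK (W μ y ν (translate M y' e))))) x w a b)) := by
  conv_rhs => rw [← translate_wrap_quo M y, ← translate_wrap_quo M y']
  rw [perF_dper_woundEven_translate_fst_of n M W hWt μ (wrap M y : Site (3 + 1)) ν (translate M (wrap M y' : Site (3 + 1)) (quo M y')) (quo M y),
    perF_dper_woundEven_translate_snd_of n M W μ (wrap M y : Site (3 + 1)) ν (wrap M y' : Site (3 + 1)) (quo M y')]

end Generic

/-! ## §2 The instance: the GRADED composite second-order family of (T1) (an2 PART 93) is jointly block-covariant -/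

section Graded

variable {Lc : ℕ} [NeZero Lc] (R : Roots Lc) (P : Pins) (n : ℕ) (M : Fin (3 + 1) → ℕ)

/-- [folklore] **`WNG_translate_eq_shiftK` — THE GRADED N SECOND-ORDER FAMILY IS JOINTLY BLOCK-COVARIANT**:
`WNG (n+1) μ (y+t) ν (y′+t) = shiftK (−Lc^(n+2)•t) (WNG (n+1) μ y ν y′)` for `WNG (n+1) := WchartOf (fun _ => compChart R.rc Lc (n+2) (R.s (n+2)) (Lc^(n+2))) (tabsCompG (n+2) …) (P.cE (n+2)) …
(P.T (n+2)) 0` (lit `W2SymOfK_translate` at PART 93 `WNG_eq_W2SymOfK` with PART 16 `shiftK_AN`, PART 93 `SNG_translate ∕ T2NG_translate`, the graded record's `hMt ∕ hmixt` —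
PART 8 `WN_translate_eq_shiftK`'s proof with the graded names). -/
theorem WNG_translate_eq_shiftK (μ : Fin (3 + 1)) (y : Site (3 + 1)) (ν : Fin (3 + 1)) (y' t : Site (3 + 1)) :
    (WchartOf (fun _ => compChart R.rc Lc (n + 1 + 1) (R.s (n + 1 + 1)) (Lc ^ (n + 1 + 1))) (tabsCompG (n + 1 + 1) (one_le_of_neZero Lc) R.hr (P.cM (n + 1 + 1)))
        (P.cE (n + 1 + 1)) (P.cVH (n + 1 + 1)) (P.cΛ (n + 1 + 1)) (P.cE₂ (n + 1 + 1)) (P.cB (n + 1 + 1)) (P.T (n + 1 + 1)) 0) μ (y + t) ν (y' + t)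
      = shiftK (-(((Lc ^ (n + 1 + 1) : ℕ) : ℤ) • t))
        ((WchartOf (fun _ => compChart R.rc Lc (n + 1 + 1) (R.s (n + 1 + 1)) (Lc ^ (n + 1 + 1))) (tabsCompG (n + 1 + 1) (one_le_of_neZero Lc) R.hr (P.cM (n + 1 + 1)))
          (P.cE (n + 1 + 1)) (P.cVH (n + 1 + 1)) (P.cΛ (n + 1 + 1)) (P.cE₂ (n + 1 + 1)) (P.cB (n + 1 + 1)) (P.T (n + 1 + 1)) 0) μ y ν y') := by
  rw [WNG_eq_W2SymOfK]
  exact W2SymOfK_translate (N := Lc ^ (n + 1 + 1)) (shiftK_AN R (n + 1) 0) (SNG_translate R P (n + 1) 0)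
    ((tabsCompG (n + 1 + 1) (one_le_of_neZero Lc) R.hr (P.cM (n + 1 + 1))).hMt 0) (T2NG_translate R P (n + 1) 0)
    (M2Of_translate (Lc := Lc ^ (n + 1 + 1)) (tabsCompG (n + 1 + 1) (one_le_of_neZero Lc) R.hr (P.cM (n + 1 + 1))).hmixt 0) μ y ν y' t

/-- [folklore] **`perF_dper_woundEvenG_wrap`** — PART 8's `perF_dper_woundEven_wrap` for the GRADED family: both labels at `wrap M` (§1 at `hWt := WNG_translate_eq_shiftK`). -/
theorem perF_dper_woundEvenG_wrap [∀ μ, NeZero (M μ)] (μ : Fin (3 + 1)) (y : Site (3 + 1)) (ν : Fin (3 + 1)) (y' : Site (3 + 1)) :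
    perF (towerTorus Lc (fine Lc M) (n + 1)) (dper (towerTorus Lc (fine Lc M) (n + 1))
        (fun x w a b => ∑' e : Site (3 + 1), ((1 / 2 : ℝ) •
          ((WchartOf (fun _ => compChart R.rc Lc (n + 1 + 1) (R.s (n + 1 + 1)) (Lc ^ (n + 1 + 1))) (tabsCompG (n + 1 + 1) (one_le_of_neZero Lc) R.hr (P.cM (n + 1 + 1)))
              (P.cE (n + 1 + 1)) (P.cVH (n + 1 + 1)) (P.cΛ (n + 1 + 1)) (P.cE₂ (n + 1 + 1)) (P.cB (n + 1 + 1)) (P.T (n + 1 + 1)) 0) μ (wrap M y : Site (3 + 1)) ν (translate M (wrap M y' : Site (3 + 1)) e)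
          + sgnK (trK ((WchartOf (fun _ => compChart R.rc Lc (n + 1 + 1) (R.s (n + 1 + 1)) (Lc ^ (n + 1 + 1))) (tabsCompG (n + 1 + 1) (one_le_of_neZero Lc) R.hr (P.cM (n + 1 + 1)))
              (P.cE (n + 1 + 1)) (P.cVH (n + 1 + 1)) (P.cΛ (n + 1 + 1)) (P.cE₂ (n + 1 + 1)) (P.cB (n + 1 + 1)) (P.T (n + 1 + 1)) 0) μ (wrap M y : Site (3 + 1)) ν (translate M (wrap M y' : Site (3 + 1)) e))))) x w a b))
      = perF (towerTorus Lc (fine Lc M) (n + 1)) (dper (towerTorus Lc (fine Lc M) (n + 1))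
        (fun x w a b => ∑' e : Site (3 + 1), ((1 / 2 : ℝ) •
          ((WchartOf (fun _ => compChart R.rc Lc (n + 1 + 1) (R.s (n + 1 + 1)) (Lc ^ (n + 1 + 1))) (tabsCompG (n + 1 + 1) (one_le_of_neZero Lc) R.hr (P.cM (n + 1 + 1)))
              (P.cE (n + 1 + 1)) (P.cVH (n + 1 + 1)) (P.cΛ (n + 1 + 1)) (P.cE₂ (n + 1 + 1)) (P.cB (n + 1 + 1)) (P.T (n + 1 + 1)) 0) μ y ν (translate M y' e)
          + sgnK (trK ((WchartOf (fun _ => compChart R.rc Lc (n + 1 + 1) (R.s (n + 1 + 1)) (Lc ^ (n + 1 + 1))) (tabsCompG (n + 1 + 1) (one_le_of_neZero Lc) R.hr (P.cM (n + 1 + 1)))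
              (P.cE (n + 1 + 1)) (P.cVH (n + 1 + 1)) (P.cΛ (n + 1 + 1)) (P.cE₂ (n + 1 + 1)) (P.cB (n + 1 + 1)) (P.T (n + 1 + 1)) 0) μ y ν (translate M y' e))))) x w a b)) :=
  perF_dper_woundEven_wrap_of n M _ (WNG_translate_eq_shiftK R P n) μ y ν y'

end Graded

end Summit.QuantumFields.BalabanUV.Beta.FP.WoundEvenCovariantFamily

end
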